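import Summits.ResolutionOfSingularities.ResolutionOfSingularities.Theorems.HilbertSamuelEliminationSigmaMaxModificationsCorridor3WLadderIsoTailsEmbeddedStepIdeal
import Summits.ResolutionOfSingularities.ResolutionOfSingularities.Theorems.HilbertSamuelEliminationSigmaMaxModificationsCorridor3WLadderIsoTailsFreeRationalTower
import HarnessLib

/-!
# [OURS · L1 W4.2] D14 K1, ROUTE G v2 «ARC LIMIT», object **G2a — IDEAL STRICT TRANSFORMS**, part 2: the FREE-RATIONAL step for an
# ARBITRARY kernel — origin presentation at the prescribed `t`, r.s.p. `(t, c_k/t − ã_k)`, and the frame socket in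
# res-L1-w42-lead-1's currency (chart algebra `blowupAlgebra (maximalIdeal R) t`, point = a MAXIMAL ideal)
# (crux chain w42, line `w_ladder` v8.3, kernel K1 `IsoFreeRationalTailsImpossible` in every embedding dimension;
# `--supports stmt-ResolutionOfSingularities-19249`, helper)

OURS (cell `res-hironaka`, slot ★L-G4 W4.2, hand res-type-071 per res-L1-w42-plan-1 RULING v3.14-20 (FO) «G2a := 071»; spec =
res-L1-w42-lead-1's `ROUTE-G-ARCLIMIT.md` sha16 `96c77a196e17bc23` §4 G2a). NOT a statement of H. Hironaka's manuscript [Hironaka2017]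
(under review in the cell, unused here) nor of [CossartJannsenSaito2020] / [CossartPiltant2008]; AI-written, weaker than expert review.
Sorry-free PROOF file: no definitions, no named facts. Generalises `exists_origin_presentation` (p524808), `exists_maximalIdeal_presentation`
(p525782) and their tower forms (p526483) from a principal kernel `(h)` to an ARBITRARY kernel `K = ker σ`, on top of part 1
(`exists_stalk_presentation_ideal`, `…IsoTailsEmbeddedStepIdeal`): the shift / unit / origin arguments never used the equation.

* `exists_origin_presentation_ideal` — (FREE) `π♯σ(t) ∣ π♯σ(c_k)` at `t = c_{j₀}` + (RAT) `κ(x) → κ(x′)` onto ⇒ lifts `ã` and the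
  presentation of part 1 w.r.t. the shifted r.s.p. `c̃ = shiftRsop c j₀ ã` AT THE INDEX `j₀`, `x′` the ORIGIN (`c̃_k/t ∈ 𝔔`),
  `R′ = R[𝔪/t]_𝔔` regular local with `μ(𝔪_{R′}) = d`, r.s.p. `(t/1, (c̃_k/t)/1)`, `R → κ(R′)` onto, kernel clauses
  (⊇)/(sat)/(exact) (`ker σ′ = sat_t(K·R′)`).
* `exists_maximalIdeal_presentation_ideal` — the same in lead-1's currency: `𝔑` a MAXIMAL ideal of `blowupAlgebra (maximalIdeal R) t`
  containing `t/1` and `c_k/t − ã_k`.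
* `exists_maximalIdeal_presentation_ideal_of_eq`, `exists_maximalIdeal_presentation_ideal_tower` — base point named / along a
  Literature `BlowupTower` ((RAT) = `IsRationalStep T pt n`; the next (FREE) from `not_isSatelliteStep_iff_forall_dvd_of_eq`).

## References
* V. Cossart, O. Piltant, J. Algebra 320 (2008), proof of Lemma 4.3 (3). [CossartPiltant2008]
* U. Görtz, T. Wedhorn, *Algebraic Geometry I*, 2nd ed. (2020), (13.19), Prop. 13.91, Prop. 13.96 (2). [GortzWedhorn2020]
* V. Cossart, U. Jannsen, S. Saito, LNM 2270 (2020), Def. 6.34 (6.25). [CossartJannsenSaito2020]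
-/

noncomputable section

-- the mandated cell namespace `Summit.ResolutionOfSingularities.ResolutionOfSingularities.…` re-enters the summit name
set_option linter.dupNamespace false

open CategoryTheory AlgebraicGeometry TopologicalSpace IsLocalRing
open Literature.AlgebraicGeometry.Resolution
open Summit.ResolutionOfSingularities.ResolutionOfSingularities.Cruxes.SigmaMaxModifications.IdeasL1C5
  (IsRationalStep IsSatelliteStep)

open Literature.AlgebraicGeometry.CossartJannsenSaito2020

namespace Summit.ResolutionOfSingularities.ResolutionOfSingularities.Cruxes.SigmaMaxModifications.IdeasL1C5.EmbeddedStep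

universe u

section FreeRationalIdeal

variable {X X' : Scheme.{u}} {π : X' ⟶ X} {D : X.IdealSheafData}

set_option maxHeartbeats 1600000 in
-- long existential packaging over the affine blowup algebra of a stalk (as in `BlowupStalkBlowupAlgebra.lean`)
/-- **G2a — THE FREE-RATIONAL STEP FOR AN ARBITRARY KERNEL** (origin presentation at a prescribed chart); see the module docstring.
[cite: CossartPiltant2008, proof of Lemma 4.3 (3); GortzWedhorn2020, Prop. 13.96 (2)] -/
theorem exists_origin_presentation_ideal (hπ : IsBlowup π D) (x' : X')
    (hD : stalkIdeal D (π x') = maximalIdeal (X.presheaf.stalk (π x')))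
    {R : Type u} [CommRing R] [IsRegularLocalRing R] {d : ℕ} (hd : (maximalIdeal R).spanFinrank = d)
    (c : Fin d → R) (hc : Ideal.span (Set.range c) = maximalIdeal R)
    (σ : R →+* X.presheaf.stalk (π x')) (hσ : Function.Surjective σ) (j₀ : Fin d)
    (hfree : ∀ k, (π.stalkMap x').hom (σ (c j₀)) ∣ (π.stalkMap x').hom (σ (c k)))
    (hrat : Function.Surjective (IsLocalRing.ResidueField.map (π.stalkMap x').hom)) :
    ∃ (a : {k : Fin d // k ≠ j₀} → R)
      (𝔔 : PrimeSpectrum (blowupAlgebra (Ideal.span (Set.range (shiftRsop c j₀ a))) (shiftRsop c j₀ a j₀)))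
      (σ' : Localization.AtPrime 𝔔.asIdeal →+* X'.presheaf.stalk x'),
      Prime (algebraMap R (blowupAlgebra (Ideal.span (Set.range (shiftRsop c j₀ a))) (shiftRsop c j₀ a j₀))
        (shiftRsop c j₀ a j₀)) ∧
      𝔔.asIdeal.comap (algebraMap R _) = maximalIdeal R ∧
      IsRegularLocalRing (Localization.AtPrime 𝔔.asIdeal) ∧
      Function.Surjective σ' ∧
      ((RingHom.ker σ).map (algebraMap R (blowupAlgebra (Ideal.span (Set.range (shiftRsop c j₀ a))) (shiftRsop c j₀ a j₀)))).map
        (algebraMap _ (Localization.AtPrime 𝔔.asIdeal)) ≤ RingHom.ker σ' ∧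
      (∀ g, algebraMap _ (Localization.AtPrime 𝔔.asIdeal)
        (algebraMap R (blowupAlgebra (Ideal.span (Set.range (shiftRsop c j₀ a))) (shiftRsop c j₀ a j₀))
          (shiftRsop c j₀ a j₀)) * g ∈ RingHom.ker σ' → g ∈ RingHom.ker σ') ∧
      (∀ g, g ∈ RingHom.ker σ' → ∃ N : ℕ, algebraMap _ (Localization.AtPrime 𝔔.asIdeal)
        (algebraMap R (blowupAlgebra (Ideal.span (Set.range (shiftRsop c j₀ a))) (shiftRsop c j₀ a j₀))
          (shiftRsop c j₀ a j₀)) ^ N * g ∈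
          ((RingHom.ker σ).map (algebraMap R (blowupAlgebra (Ideal.span (Set.range (shiftRsop c j₀ a)))
            (shiftRsop c j₀ a j₀)))).map (algebraMap _ (Localization.AtPrime 𝔔.asIdeal))) ∧
      (∀ r : R, σ' (algebraMap _ (Localization.AtPrime 𝔔.asIdeal)
        (algebraMap R (blowupAlgebra (Ideal.span (Set.range (shiftRsop c j₀ a))) (shiftRsop c j₀ a j₀)) r)) =
          (π.stalkMap x').hom (σ r)) ∧
      (∀ k : Fin d, σ' (algebraMap _ (Localization.AtPrime 𝔔.asIdeal) (blowupAlgebra.frac (shiftRsop c j₀ a) j₀ k)) *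
        (π.stalkMap x').hom (σ (shiftRsop c j₀ a j₀)) = (π.stalkMap x').hom (σ (shiftRsop c j₀ a k))) ∧
      (π.stalkMap x').hom (σ (shiftRsop c j₀ a j₀)) ∈ nonZeroDivisors (X'.presheaf.stalk x') ∧
      stalkIdeal (D.comap π) x' = Ideal.span {(π.stalkMap x').hom (σ (shiftRsop c j₀ a j₀))} ∧
      (∀ k, k ≠ j₀ → blowupAlgebra.frac (shiftRsop c j₀ a) j₀ k ∈ 𝔔.asIdeal) ∧
      (maximalIdeal (Localization.AtPrime 𝔔.asIdeal)).spanFinrank = d ∧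
      Ideal.span (Set.range fun k : Fin d =>
        if k = j₀ then algebraMap _ (Localization.AtPrime 𝔔.asIdeal)
          (algebraMap R (blowupAlgebra (Ideal.span (Set.range (shiftRsop c j₀ a))) (shiftRsop c j₀ a j₀))
            (shiftRsop c j₀ a j₀))
        else algebraMap _ (Localization.AtPrime 𝔔.asIdeal) (blowupAlgebra.frac (shiftRsop c j₀ a) j₀ k)) =
        maximalIdeal (Localization.AtPrime 𝔔.asIdeal) ∧
      Function.Surjective ((IsLocalRing.residue (Localization.AtPrime 𝔔.asIdeal)).comp
        ((algebraMap _ (Localization.AtPrime 𝔔.asIdeal)).comp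
          (algebraMap R (blowupAlgebra (Ideal.span (Set.range (shiftRsop c j₀ a))) (shiftRsop c j₀ a j₀))))) := by
  classical
  -- (0) coordinates of the rational point in the `t`-chart: `π♯σ(c_k) = π♯σ(t) · w_k`, `w_k ≡ π♯σ(r_k) mod 𝔪_{x′}`
  have hcoord : ∀ k, ∃ r : R, ∃ w : X'.presheaf.stalk x',
      (π.stalkMap x').hom (σ (c k)) = (π.stalkMap x').hom (σ (c j₀)) * w ∧
      w - (π.stalkMap x').hom (σ r) ∈ maximalIdeal _ := by
    intro k
    obtain ⟨w, hw⟩ := hfree k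
    obtain ⟨ρ, hρ⟩ := hrat (IsLocalRing.residue _ w)
    obtain ⟨y, rfl⟩ := Ideal.Quotient.mk_surjective ρ
    obtain ⟨r, rfl⟩ := hσ y
    refine ⟨r, w, hw, ?_⟩
    rw [← Ideal.Quotient.eq]
    change IsLocalRing.residue _ w = IsLocalRing.residue _ ((π.stalkMap x').hom (σ r))
    rw [← hρ]
    rfl
  choose r w hw hwr using hcoord
  refine ⟨fun k => r k.1, ?_⟩
  -- (1) the shifted system and the presentation of part 1 with respect to it
  have hc₂ : Ideal.span (Set.range (shiftRsop c j₀ fun k => r k.1)) = maximalIdeal R := by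
    rw [span_range_shiftRsop, hc]
  obtain ⟨j₂, 𝔔, σ', h2, h4, h6, h7, hsub, hsat, hexact, h9, h10, h11, h12⟩ :=
    exists_stalk_presentation_ideal hπ x' hD hd (shiftRsop c j₀ fun k => r k.1) hc₂ σ hσ
  have hc₂j : (π.stalkMap x').hom (σ (shiftRsop c j₀ (fun k => r k.1) j₀)) = (π.stalkMap x').hom (σ (c j₀)) := by
    rw [shiftRsop_self]
  have hc₂k : ∀ k (hk : k ≠ j₀), (π.stalkMap x').hom (σ (shiftRsop c j₀ (fun k => r k.1) k)) =
      (π.stalkMap x').hom (σ (c j₀)) * (w k - (π.stalkMap x').hom (σ (r k))) := by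
    intro k hk
    rw [shiftRsop_of_ne c j₀ _ hk, map_sub, map_mul, map_sub, map_mul, hw k]
    ring
  -- (2) `g = π♯σ(t)` is a non-zero-divisor: it divides the non-zero-divisor `π♯σ(c̃_{j₂})`
  have hgnzd : (π.stalkMap x').hom (σ (c j₀)) ∈ nonZeroDivisors (X'.presheaf.stalk x') := by
    by_cases hj : j₂ = j₀
    · subst hj; rw [← hc₂j]; exact h11
    · have h11' := h11
      rw [hc₂k j₂ hj] at h11'
      exact (mul_mem_nonZeroDivisors.mp h11').1
  -- (3) the chart index is forced: `j₂ = j₀`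
  have hj : j₂ = j₀ := by
    by_contra hj
    have e10 := h10 j₀
    rw [hc₂j, hc₂k j₂ hj] at e10
    have hμ : σ' (algebraMap _ _ (blowupAlgebra.frac (shiftRsop c j₀ fun k => r k.1) j₂ j₀)) *
        (w j₂ - (π.stalkMap x').hom (σ (r j₂))) ∈ maximalIdeal (X'.presheaf.stalk x') :=
      Ideal.mul_mem_left _ _ (hwr j₂)
    have hunit := IsLocalRing.isUnit_one_sub_self_of_mem_nonunits _ hμ
    have hzero : (π.stalkMap x').hom (σ (c j₀)) *
        (1 - σ' (algebraMap _ _ (blowupAlgebra.frac (shiftRsop c j₀ fun k => r k.1) j₂ j₀)) *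
          (w j₂ - (π.stalkMap x').hom (σ (r j₂)))) = 0 := by
      rw [mul_sub, mul_one, sub_eq_zero]
      calc (π.stalkMap x').hom (σ (c j₀))
          = σ' (algebraMap _ _ (blowupAlgebra.frac (shiftRsop c j₀ fun k => r k.1) j₂ j₀)) *
              ((π.stalkMap x').hom (σ (c j₀)) * (w j₂ - (π.stalkMap x').hom (σ (r j₂)))) := e10.symm
        _ = _ := by ring
    have hg0 := (hunit.mul_left_eq_zero).mp hzero
    rw [hg0] at hgnzd
    exact zero_notMem_nonZeroDivisors hgnzd
  subst hj
  -- (4) the point is the ORIGIN: `c̃_k/t ∈ 𝔔` for `k ≠ j₂ (= j₀)`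
  have horig : ∀ k, k ≠ j₂ → blowupAlgebra.frac (shiftRsop c j₂ fun k => r k.1) j₂ k ∈ 𝔔.asIdeal := by
    intro k hk
    have e10 := h10 k
    rw [hc₂j, hc₂k k hk, mul_comm ((π.stalkMap x').hom (σ (c j₂)))] at e10
    have hs : σ' (algebraMap _ _ (blowupAlgebra.frac (shiftRsop c j₂ fun k => r k.1) j₂ k)) =
        w k - (π.stalkMap x').hom (σ (r k)) := (mul_cancel_right_mem_nonZeroDivisors hgnzd).mp e10
    have hsm : σ' (algebraMap _ _ (blowupAlgebra.frac (shiftRsop c j₂ fun k => r k.1) j₂ k)) ∈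
        maximalIdeal (X'.presheaf.stalk x') := hs ▸ hwr k
    have hL : algebraMap _ (Localization.AtPrime 𝔔.asIdeal)
        (blowupAlgebra.frac (shiftRsop c j₂ fun k => r k.1) j₂ k) ∈ maximalIdeal _ := by
      rw [IsLocalRing.mem_maximalIdeal, mem_nonunits_iff] at hsm ⊢
      exact fun hu => hsm (hu.map σ')
    exact (IsLocalization.AtPrime.to_map_mem_maximal_iff (Localization.AtPrime 𝔔.asIdeal) 𝔔.asIdeal _).mp hL
  -- (5) the regular system of parameters at the origin
  obtain ⟨-, hdim, hspan, hres⟩ := origin_rsop (shiftRsop c j₂ fun k => r k.1) j₂ hd hc₂ 𝔔.asIdeal h4 horig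
    (Localization.AtPrime 𝔔.asIdeal)
  exact ⟨𝔔, σ', h2, h4, h6, h7, hsub, hsat, hexact, h9, h10, h11, h12, horig, hdim, hspan, hres⟩

end FreeRationalIdeal

/-! ## The frame socket for an arbitrary kernel (lead-1's currency `blowupAlgebra (maximalIdeal R) t`) -/

section FrameSocketIdeal

variable {R : Type u} [CommRing R] {d : ℕ} (c : Fin d → R) (j : Fin d)
  {X X' : Scheme.{u}} {π : X' ⟶ X} {D : X.IdealSheafData}

set_option maxHeartbeats 1600000 in
-- long existential packaging over the affine blowup algebra of a stalk (as in `BlowupStalkBlowupAlgebra.lean`)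
/-- **G2a — THE FRAME SOCKET FOR AN ARBITRARY KERNEL**: `exists_origin_presentation_ideal` re-typed over
`blowupAlgebra (maximalIdeal R) t`, `t = c_j`, with the point a MAXIMAL ideal `𝔑 ∋ t/1, c_k/t − ã_k`, `R′ = R[𝔪/t]_𝔑` regular local of
embedding dimension `d` with r.s.p. `(t/1, (c_k/t − ã_k)/1)`, `R → κ(R′)` onto, `σ′ : R′ ↠ 𝒪_{X′,x′}` extending `π♯ ∘ σ`, kernel
`ker σ′ = sat_t(K·R′)` as (⊇)/(sat)/(exact), `𝓘(E)_{x′} = (π♯σ(t))`, `π♯σ(t)` a non-zero-divisor.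
[cite: CossartPiltant2008, proof of Lemma 4.3 (3); GortzWedhorn2020, Prop. 13.96 (2)] -/
theorem exists_maximalIdeal_presentation_ideal (hπ : IsBlowup π D) (x' : X')
    (hD : stalkIdeal D (π x') = maximalIdeal (X.presheaf.stalk (π x')))
    [IsRegularLocalRing R] (hd : (maximalIdeal R).spanFinrank = d)
    (hc : Ideal.span (Set.range c) = maximalIdeal R)
    (σ : R →+* X.presheaf.stalk (π x')) (hσ : Function.Surjective σ)
    (hfree : ∀ k, (π.stalkMap x').hom (σ (c j)) ∣ (π.stalkMap x').hom (σ (c k)))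
    (hrat : Function.Surjective (IsLocalRing.ResidueField.map (π.stalkMap x').hom)) :
    ∃ (a : {k : Fin d // k ≠ j} → R) (𝔑 : Ideal (blowupAlgebra (maximalIdeal R) (c j))) (_ : 𝔑.IsMaximal)
      (σ' : Localization.AtPrime 𝔑 →+* X'.presheaf.stalk x'),
      Prime (algebraMap R (blowupAlgebra (maximalIdeal R) (c j)) (c j)) ∧
      𝔑.comap (algebraMap R _) = maximalIdeal R ∧
      algebraMap R (blowupAlgebra (maximalIdeal R) (c j)) (c j) ∈ 𝔑 ∧
      (∀ k (hk : k ≠ j), blowupAlgebra.gen (maximalIdeal R) (c j) (c k) (hc.le (Ideal.subset_span ⟨k, rfl⟩)) -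
        algebraMap R _ (a ⟨k, hk⟩) ∈ 𝔑) ∧
      IsRegularLocalRing (Localization.AtPrime 𝔑) ∧
      (maximalIdeal (Localization.AtPrime 𝔑)).spanFinrank = d ∧
      Ideal.span (Set.range fun k : Fin d =>
        if hk : k = j then algebraMap _ (Localization.AtPrime 𝔑) (algebraMap R (blowupAlgebra (maximalIdeal R) (c j)) (c j))
        else algebraMap _ (Localization.AtPrime 𝔑)
          (blowupAlgebra.gen (maximalIdeal R) (c j) (c k) (hc.le (Ideal.subset_span ⟨k, rfl⟩)) -
            algebraMap R _ (a ⟨k, hk⟩))) = maximalIdeal (Localization.AtPrime 𝔑) ∧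
      Function.Surjective σ' ∧
      ((RingHom.ker σ).map (algebraMap R (blowupAlgebra (maximalIdeal R) (c j)))).map
        (algebraMap _ (Localization.AtPrime 𝔑)) ≤ RingHom.ker σ' ∧
      (∀ g, algebraMap _ (Localization.AtPrime 𝔑) (algebraMap R (blowupAlgebra (maximalIdeal R) (c j)) (c j)) * g ∈
        RingHom.ker σ' → g ∈ RingHom.ker σ') ∧
      (∀ g, g ∈ RingHom.ker σ' → ∃ N : ℕ, algebraMap _ (Localization.AtPrime 𝔑)
        (algebraMap R (blowupAlgebra (maximalIdeal R) (c j)) (c j)) ^ N * g ∈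
          ((RingHom.ker σ).map (algebraMap R (blowupAlgebra (maximalIdeal R) (c j)))).map
            (algebraMap _ (Localization.AtPrime 𝔑))) ∧
      (∀ r : R, σ' (algebraMap _ (Localization.AtPrime 𝔑) (algebraMap R (blowupAlgebra (maximalIdeal R) (c j)) r)) =
        (π.stalkMap x').hom (σ r)) ∧
      (π.stalkMap x').hom (σ (c j)) ∈ nonZeroDivisors (X'.presheaf.stalk x') ∧
      stalkIdeal (D.comap π) x' = Ideal.span {(π.stalkMap x').hom (σ (c j))} ∧
      Function.Surjective ((IsLocalRing.residue (Localization.AtPrime 𝔑)).comp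
        ((algebraMap _ (Localization.AtPrime 𝔑)).comp (algebraMap R (blowupAlgebra (maximalIdeal R) (c j))))) := by
  classical
  obtain ⟨a, 𝔔, σ', h2, h4, h6, h7, hsub, hsat, hexact, h9, -, h11, h12, h13, h14, h15, h16⟩ :=
    exists_origin_presentation_ideal hπ x' hD hd c hc σ hσ j hfree hrat
  refine ⟨a, ?_⟩
  have hI : Ideal.span (Set.range (shiftRsop c j a)) = maximalIdeal R := by rw [span_range_shiftRsop, hc]
  have ht : shiftRsop c j a j = c j := shiftRsop_self c j a
  have hmax : 𝔔.asIdeal.IsMaximal := isMaximal_origin_blowupAlgebra (shiftRsop c j a) j 𝔔.asIdeal h4 h13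
  -- transport along `span (range c̃) = 𝔪`, `c̃_j = c_j` by generalisation
  have key : ∀ (I : Ideal R) (t : R), Ideal.span (Set.range (shiftRsop c j a)) = I → shiftRsop c j a j = t →
      ∀ (hck : ∀ k, c k ∈ I),
      ∃ (𝔑 : Ideal (blowupAlgebra I t)) (_ : 𝔑.IsMaximal) (σ' : Localization.AtPrime 𝔑 →+* X'.presheaf.stalk x'),
        Prime (algebraMap R (blowupAlgebra I t) t) ∧
        𝔑.comap (algebraMap R _) = maximalIdeal R ∧
        algebraMap R (blowupAlgebra I t) t ∈ 𝔑 ∧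
        (∀ k (hk : k ≠ j), blowupAlgebra.gen I t (c k) (hck k) - algebraMap R _ (a ⟨k, hk⟩) ∈ 𝔑) ∧
        IsRegularLocalRing (Localization.AtPrime 𝔑) ∧
        (maximalIdeal (Localization.AtPrime 𝔑)).spanFinrank = d ∧
        Ideal.span (Set.range fun k : Fin d =>
          if hk : k = j then algebraMap _ (Localization.AtPrime 𝔑) (algebraMap R (blowupAlgebra I t) t)
          else algebraMap _ (Localization.AtPrime 𝔑)
            (blowupAlgebra.gen I t (c k) (hck k) - algebraMap R _ (a ⟨k, hk⟩))) =
          maximalIdeal (Localization.AtPrime 𝔑) ∧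
        Function.Surjective σ' ∧
        ((RingHom.ker σ).map (algebraMap R (blowupAlgebra I t))).map (algebraMap _ (Localization.AtPrime 𝔑)) ≤
          RingHom.ker σ' ∧
        (∀ g, algebraMap _ (Localization.AtPrime 𝔑) (algebraMap R (blowupAlgebra I t) t) * g ∈ RingHom.ker σ' →
          g ∈ RingHom.ker σ') ∧
        (∀ g, g ∈ RingHom.ker σ' → ∃ N : ℕ, algebraMap _ (Localization.AtPrime 𝔑) (algebraMap R (blowupAlgebra I t) t) ^ N * g ∈
          ((RingHom.ker σ).map (algebraMap R (blowupAlgebra I t))).map (algebraMap _ (Localization.AtPrime 𝔑))) ∧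
        (∀ r : R, σ' (algebraMap _ (Localization.AtPrime 𝔑) (algebraMap R (blowupAlgebra I t) r)) =
          (π.stalkMap x').hom (σ r)) ∧
        (π.stalkMap x').hom (σ t) ∈ nonZeroDivisors (X'.presheaf.stalk x') ∧
        stalkIdeal (D.comap π) x' = Ideal.span {(π.stalkMap x').hom (σ t)} ∧
        Function.Surjective ((IsLocalRing.residue (Localization.AtPrime 𝔑)).comp
          ((algebraMap _ (Localization.AtPrime 𝔑)).comp (algebraMap R (blowupAlgebra I t)))) := by
    intro I t hI' ht' hck
    subst hI' ht'
    have hgen : ∀ k (hk : k ≠ j),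
        blowupAlgebra.gen (Ideal.span (Set.range (shiftRsop c j a))) (shiftRsop c j a j) (c k) (hck k) -
          algebraMap R _ (a ⟨k, hk⟩) = blowupAlgebra.frac (shiftRsop c j a) j k := by
      intro k hk
      have hxa : c k - a ⟨k, hk⟩ * shiftRsop c j a j ∈ Ideal.span (Set.range (shiftRsop c j a)) := by
        rw [shiftRsop_self, ← shiftRsop_of_ne c j a hk]
        exact blowupAlgebra.mem_span_range _ k
      rw [← gen_sub_mul_eq (Ideal.span (Set.range (shiftRsop c j a))) (shiftRsop c j a j)
        (blowupAlgebra.mem_span_range _ j) (hck k) (a ⟨k, hk⟩) hxa]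
      unfold blowupAlgebra.frac
      congr 1
      rw [shiftRsop_of_ne c j a hk, shiftRsop_self]
    have htj : algebraMap R (blowupAlgebra (Ideal.span (Set.range (shiftRsop c j a))) (shiftRsop c j a j))
        (shiftRsop c j a j) ∈ 𝔔.asIdeal := by
      rw [← Ideal.mem_comap, h4, ← hc, shiftRsop_self]
      exact Ideal.subset_span ⟨j, rfl⟩
    have hfam : (fun k : Fin d =>
        if hk : k = j then algebraMap _ (Localization.AtPrime 𝔔.asIdeal)
          (algebraMap R (blowupAlgebra (Ideal.span (Set.range (shiftRsop c j a))) (shiftRsop c j a j)) (shiftRsop c j a j))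
        else algebraMap _ (Localization.AtPrime 𝔔.asIdeal)
          (blowupAlgebra.gen (Ideal.span (Set.range (shiftRsop c j a))) (shiftRsop c j a j) (c k) (hck k) -
            algebraMap R _ (a ⟨k, hk⟩))) =
        (fun k : Fin d =>
        if k = j then algebraMap _ (Localization.AtPrime 𝔔.asIdeal)
          (algebraMap R (blowupAlgebra (Ideal.span (Set.range (shiftRsop c j a))) (shiftRsop c j a j)) (shiftRsop c j a j))
        else algebraMap _ (Localization.AtPrime 𝔔.asIdeal) (blowupAlgebra.frac (shiftRsop c j a) j k)) := by
      funext k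
      by_cases hk : k = j
      · rw [dif_pos hk, if_pos hk]
      · rw [dif_neg hk, if_neg hk, hgen k hk]
    refine ⟨𝔔.asIdeal, hmax, σ', h2, h4, htj, fun k hk => ?_, h6, h14, ?_, h7, hsub, hsat, hexact, h9, h11, h12, h16⟩
    · rw [hgen k hk]; exact h13 k hk
    · rw [hfam]; exact h15
  exact key (maximalIdeal R) (c j) hI ht fun k => hc.le (Ideal.subset_span ⟨k, rfl⟩)

set_option maxHeartbeats 1600000 in
-- long existential packaging over the affine blowup algebra of a stalk (as in `BlowupStalkBlowupAlgebra.lean`)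
/-- **The socket for an arbitrary kernel, base point named** (`π x′ = x` as an equation). [cite: CossartPiltant2008, proof of Lemma 4.3 (3)] -/
theorem exists_maximalIdeal_presentation_ideal_of_eq (hπ : IsBlowup π D) (x' : X') (x : X) (hx : π x' = x)
    (hD : stalkIdeal D x = maximalIdeal (X.presheaf.stalk x))
    [IsRegularLocalRing R] (hd : (maximalIdeal R).spanFinrank = d)
    (hc : Ideal.span (Set.range c) = maximalIdeal R)
    (σ : R →+* X.presheaf.stalk x) (hσ : Function.Surjective σ)
    (hfree : ∀ k, (π.stalkMap x').hom ((X.presheaf.stalkCongr (.of_eq hx)).inv (σ (c j))) ∣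
      (π.stalkMap x').hom ((X.presheaf.stalkCongr (.of_eq hx)).inv (σ (c k))))
    (hrat : Function.Surjective (IsLocalRing.ResidueField.map (π.stalkMap x').hom)) :
    ∃ (a : {k : Fin d // k ≠ j} → R) (𝔑 : Ideal (blowupAlgebra (maximalIdeal R) (c j))) (_ : 𝔑.IsMaximal)
      (σ' : Localization.AtPrime 𝔑 →+* X'.presheaf.stalk x'),
      Prime (algebraMap R (blowupAlgebra (maximalIdeal R) (c j)) (c j)) ∧
      𝔑.comap (algebraMap R _) = maximalIdeal R ∧
      algebraMap R (blowupAlgebra (maximalIdeal R) (c j)) (c j) ∈ 𝔑 ∧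
      (∀ k (hk : k ≠ j), blowupAlgebra.gen (maximalIdeal R) (c j) (c k) (hc.le (Ideal.subset_span ⟨k, rfl⟩)) -
        algebraMap R _ (a ⟨k, hk⟩) ∈ 𝔑) ∧
      IsRegularLocalRing (Localization.AtPrime 𝔑) ∧
      (maximalIdeal (Localization.AtPrime 𝔑)).spanFinrank = d ∧
      Ideal.span (Set.range fun k : Fin d =>
        if hk : k = j then algebraMap _ (Localization.AtPrime 𝔑) (algebraMap R (blowupAlgebra (maximalIdeal R) (c j)) (c j))
        else algebraMap _ (Localization.AtPrime 𝔑)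
          (blowupAlgebra.gen (maximalIdeal R) (c j) (c k) (hc.le (Ideal.subset_span ⟨k, rfl⟩)) -
            algebraMap R _ (a ⟨k, hk⟩))) = maximalIdeal (Localization.AtPrime 𝔑) ∧
      Function.Surjective σ' ∧
      ((RingHom.ker σ).map (algebraMap R (blowupAlgebra (maximalIdeal R) (c j)))).map (algebraMap _ (Localization.AtPrime 𝔑)) ≤ RingHom.ker σ' ∧
      (∀ g, algebraMap _ (Localization.AtPrime 𝔑) (algebraMap R (blowupAlgebra (maximalIdeal R) (c j)) (c j)) * g ∈ RingHom.ker σ' →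
        g ∈ RingHom.ker σ') ∧
      (∀ g, g ∈ RingHom.ker σ' → ∃ N : ℕ,
        algebraMap _ (Localization.AtPrime 𝔑) (algebraMap R (blowupAlgebra (maximalIdeal R) (c j)) (c j)) ^ N * g ∈
          ((RingHom.ker σ).map (algebraMap R (blowupAlgebra (maximalIdeal R) (c j)))).map
            (algebraMap _ (Localization.AtPrime 𝔑))) ∧
      (∀ r : R, σ' (algebraMap _ (Localization.AtPrime 𝔑) (algebraMap R (blowupAlgebra (maximalIdeal R) (c j)) r)) =
        (π.stalkMap x').hom ((X.presheaf.stalkCongr (.of_eq hx)).inv (σ r))) ∧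
      (π.stalkMap x').hom ((X.presheaf.stalkCongr (.of_eq hx)).inv (σ (c j))) ∈ nonZeroDivisors (X'.presheaf.stalk x') ∧
      stalkIdeal (D.comap π) x' = Ideal.span {(π.stalkMap x').hom ((X.presheaf.stalkCongr (.of_eq hx)).inv (σ (c j)))} ∧
      Function.Surjective ((IsLocalRing.residue (Localization.AtPrime 𝔑)).comp
        ((algebraMap _ (Localization.AtPrime 𝔑)).comp (algebraMap R (blowupAlgebra (maximalIdeal R) (c j))))) := by
  subst hx
  have hid : ∀ a : X.presheaf.stalk (π x'),
      (X.presheaf.stalkCongr (.of_eq (rfl : π x' = π x'))).inv a = a := fun a => by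
    rw [TopCat.Presheaf.stalkCongr_inv]
    exact stalkSpecializes_self_apply _ _ _ a
  simp only [hid] at hfree ⊢
  exact exists_maximalIdeal_presentation_ideal c j hπ x' hD hd hc σ hσ hfree hrat

set_option maxHeartbeats 1600000 in
-- long existential packaging over the affine blowup algebra of a stalk (as in `BlowupStalkBlowupAlgebra.lean`)
/-- **The socket for an arbitrary kernel along a point tower** (`T.C n = {x_n}`, `π_n(x_{n+1}) = x_n`; (RAT) =
`IsRationalStep T pt n`; (FREE) at `t = c_j`). [cite: CossartPiltant2008, proof of Lemma 4.3 (3); CossartJannsenSaito2020, Def. 6.34 (6.25)] -/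
theorem exists_maximalIdeal_presentation_ideal_tower (T : BlowupTower.{u}) (pt : ∀ n, T.X n) (n : ℕ)
    (hC : T.C n = {pt n}) (hcl : IsClosed ({pt n} : Set (T.X n))) (hpt : (T.π n) (pt (n + 1)) = pt n)
    [IsRegularLocalRing R] (hd : (maximalIdeal R).spanFinrank = d)
    (hc : Ideal.span (Set.range c) = maximalIdeal R)
    (σ : R →+* (T.X n).presheaf.stalk (pt n)) (hσ : Function.Surjective σ)
    (hfree : ∀ k, ((T.π n).stalkMap (pt (n + 1))).hom (((T.X n).presheaf.stalkCongr (.of_eq hpt)).inv (σ (c j))) ∣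
      ((T.π n).stalkMap (pt (n + 1))).hom (((T.X n).presheaf.stalkCongr (.of_eq hpt)).inv (σ (c k))))
    (hrat : IsRationalStep T pt n) :
    ∃ (a : {k : Fin d // k ≠ j} → R) (𝔑 : Ideal (blowupAlgebra (maximalIdeal R) (c j))) (_ : 𝔑.IsMaximal)
      (σ' : Localization.AtPrime 𝔑 →+* (T.X (n + 1)).presheaf.stalk (pt (n + 1))),
      Prime (algebraMap R (blowupAlgebra (maximalIdeal R) (c j)) (c j)) ∧
      𝔑.comap (algebraMap R _) = maximalIdeal R ∧
      algebraMap R (blowupAlgebra (maximalIdeal R) (c j)) (c j) ∈ 𝔑 ∧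
      (∀ k (hk : k ≠ j), blowupAlgebra.gen (maximalIdeal R) (c j) (c k) (hc.le (Ideal.subset_span ⟨k, rfl⟩)) -
        algebraMap R _ (a ⟨k, hk⟩) ∈ 𝔑) ∧
      IsRegularLocalRing (Localization.AtPrime 𝔑) ∧
      (maximalIdeal (Localization.AtPrime 𝔑)).spanFinrank = d ∧
      Ideal.span (Set.range fun k : Fin d =>
        if hk : k = j then algebraMap _ (Localization.AtPrime 𝔑) (algebraMap R (blowupAlgebra (maximalIdeal R) (c j)) (c j))
        else algebraMap _ (Localization.AtPrime 𝔑)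
          (blowupAlgebra.gen (maximalIdeal R) (c j) (c k) (hc.le (Ideal.subset_span ⟨k, rfl⟩)) -
            algebraMap R _ (a ⟨k, hk⟩))) = maximalIdeal (Localization.AtPrime 𝔑) ∧
      Function.Surjective σ' ∧
      ((RingHom.ker σ).map (algebraMap R (blowupAlgebra (maximalIdeal R) (c j)))).map (algebraMap _ (Localization.AtPrime 𝔑)) ≤ RingHom.ker σ' ∧
      (∀ g, algebraMap _ (Localization.AtPrime 𝔑) (algebraMap R (blowupAlgebra (maximalIdeal R) (c j)) (c j)) * g ∈ RingHom.ker σ' →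
        g ∈ RingHom.ker σ') ∧
      (∀ g, g ∈ RingHom.ker σ' → ∃ N : ℕ,
        algebraMap _ (Localization.AtPrime 𝔑) (algebraMap R (blowupAlgebra (maximalIdeal R) (c j)) (c j)) ^ N * g ∈
          ((RingHom.ker σ).map (algebraMap R (blowupAlgebra (maximalIdeal R) (c j)))).map
            (algebraMap _ (Localization.AtPrime 𝔑))) ∧
      (∀ r : R, σ' (algebraMap _ (Localization.AtPrime 𝔑) (algebraMap R (blowupAlgebra (maximalIdeal R) (c j)) r)) =
        ((T.π n).stalkMap (pt (n + 1))).hom (((T.X n).presheaf.stalkCongr (.of_eq hpt)).inv (σ r))) ∧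
      ((T.π n).stalkMap (pt (n + 1))).hom (((T.X n).presheaf.stalkCongr (.of_eq hpt)).inv (σ (c j))) ∈
        nonZeroDivisors ((T.X (n + 1)).presheaf.stalk (pt (n + 1))) ∧
      stalkIdeal ((T.centreIdeal n).comap (T.π n)) (pt (n + 1)) =
        Ideal.span {((T.π n).stalkMap (pt (n + 1))).hom (((T.X n).presheaf.stalkCongr (.of_eq hpt)).inv (σ (c j)))} ∧
      Function.Surjective ((IsLocalRing.residue (Localization.AtPrime 𝔑)).comp
        ((algebraMap _ (Localization.AtPrime 𝔑)).comp (algebraMap R (blowupAlgebra (maximalIdeal R) (c j))))) :=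
  exists_maximalIdeal_presentation_ideal_of_eq c j (T.isBlowup n) (pt (n + 1)) (pt n) hpt
    (stalkIdeal_centreIdeal_eq_maximalIdeal T pt n hC hcl) hd hc σ hσ hfree hrat

end FrameSocketIdeal

end Summit.ResolutionOfSingularities.ResolutionOfSingularities.Cruxes.SigmaMaxModifications.IdeasL1C5.EmbeddedStep

end
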